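import Literature.Barriers.ValiantsHypothesis.BDGIL24CentralCharacters
import Literature.NumberTheory.Automorphic.HarishChandraGLIsomorphism
import Literature.NumberTheory.Automorphic.HarishChandraGLExistence
import Literature.NumberTheory.DiophantineGeometry.GLHighestWeightDominanceProofs
import Literature.Barriers.ValiantsHypothesis.BDGIL24GelfandTsetlinComponents
import Literature.Barriers.ValiantsHypothesis.BDGIL24CommonEigenspaceProjectors
import Mathlib.RingTheory.Polynomial.Vieta
import HarnessLib

/-!
# Central characters separate the isotypic components of the metapolynomial representation
# ([BDGIL24, §4.4, Thm. 4.11]) — PROVED, via the tree's Harish-Chandra isomorphism for `gl_k`;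
# [BDGIL24, Cor. 5.6 and Cor. 5.7] WITH THEIR LENGTH BOUNDS — PROVED (`cor_5_6_length`, `cor_5_7_length`)

[BDGIL24] = M. van den Berg, P. Dutta, F. Gesmundo, C. Ikenmeyer, V. Lysikov, *Algebraic
metacomplexity and representation theory*, arXiv:2411.03444, §4.4 (p.20, PDF p.21; held text
paper:arxiv-2411.03444 p0021.txt:L11–L27):

> "It is a crucial fact that for Lie algebras `𝔤` of reductive groups central characters separate
> non-isomorphic irreducible representations. **Theorem 4.11** ([Rac50], see also [Bou05,
> §VIII.8.5, Cor.2]). Let `𝔤` be a reductive Lie algebra. If `V` and `W` are irreducible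
> representations of `𝔤` and the central characters `χ_V` and `χ_W` coincide, then `V` and `W` are
> isomorphic. It follows that for reductive `𝔤` the isotypic components of a `𝔤`-representation
> are also isotypic components of the induced `Z(𝔤)`-representation."

## What is typed and proved

For `gl_k` acting on the metapolynomials `ℂ[ℂ[x₁,…,x_k]_d]` (Claim 4.2; block model
`envActGL k d τ₀` of `BDGIL24CentralCharacters`, here at the index type `T = (ℝ →ₐ[ℝ] ℂ)` — a
single real embedding, so `T → gl_k ≅ gl_k` — at which the tree's Harish-Chandra ISOMORPHISM is
available):

* **`exists_center_centralChar_ne`** — Thm. 4.11 in the form used by §5.1.2: if `λ ≠ μ` both occur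
  as highest weights in `ℂ[ℂ[x]_d]` (nonzero highest weight spaces of `coordRep`), there is
  `z ∈ Z(gl_k)` with `χ_λ(z) ≠ χ_μ(z)` (central characters in the Harish-Chandra-projection form
  `(hcProj z)(λ)` of `BDGIL24CentralCharacters` / `HarishChandraCore`);
* **`exists_center_separates_hwSubrep`** — the displayed consequence: distinct nonzero isotypic
  components `hwSubrep λ`, `hwSubrep μ` of `ℂ[ℂ[x]_d]` are acted on by some `z ∈ Z(gl_k)` through
  DIFFERENT scalars (so the isotypic components are the isotypic components of the
  `Z(gl_k)`-representation);
* the separation lemma **`exists_esymm_shiftedWt_ne`**: for distinct dominant `λ, μ` some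
  elementary symmetric polynomial `e_j`, `j ≤ k`, takes different values at `λ + ρ` and `μ + ρ`
  (`ρ_i = (k-1)/2 - i`, the tree's `rhoGL`): strictly decreasing real sequences with the same
  multiset of entries coincide, and the multiset is read off `∏_i (X + (λ+ρ)_i)` (Vieta,
  `Multiset.prod_X_add_C_eq_sum_esymm`, `Polynomial.roots_multiset_prod_X_sub_C`).

Proof of `exists_center_centralChar_ne` (the printed theorem is quoted from [Rac50]/[Bou05]; the
tree proves it for `gl_k` through Harish-Chandra): occurring highest weights are dominant
(`GLHighestWeightDominanceProofs.isDominant_of_mem_highestWeightSpace`); a Harish-Chandra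
homomorphism `γ` for `gl_k(ℝ)` exists (`nonempty_harishChandraHomGL_holds`) and its
complexification `γ' : Z(U(𝔤_ℂ)) → ℂ[x]` is onto the symmetric polynomials
(`HarishChandraHomGL.complexified_injective_and_range_eq`), so `e_j = γ'(z)` for a central `z`;
`z` acts on a highest weight vector of weight `λ` by `γ'(z)(λ + ρ) = e_j(λ + ρ)`
(`HarishChandraHomGL.hasHWProperty_complexified`, with the highest weight vectors of
`BDGIL24CentralCharacters.isHighestWeightVectorC_of_mem_highestWeightSpace`) and by `χ_λ(z)`
(`envActGL_center_apply_of_mem_highestWeightSpace`).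

* (appended) **length control and the printed length bounds**: `zOfPoly_mem_fil_and_symb`,
  `gamma_zOfPoly_top`, **`exists_center_fil_gamma_eq`** (Harish-Chandra surjectivity WITH LENGTH
  CONTROL — every block-symmetric polynomial of degree `≤ d` is `γ'` of a polynomial in the Casimir
  elements lying in `U(𝔤)_{≤d}`; [BDGIL24, Thm. 4.13] «the lengths of these elements coincide with
  the degrees of the fundamental invariants»), `exists_center_fil_centralChar_ne` (Thm. 4.11 with a
  separating central element of length `≤ k`), and, following the PRINTED proofs of §5.1.2–5.1.3
  (Thm. 5.2 `thm_5_2_linearFactors` over bounded-length central elements whose Harish-Chandra images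
  are `e_1,…,e_k`), **`cor_5_6_length`** — `Z_λ ∈ U(gl_k)_{≤ k(δd+1)^k}` acting on `ℂ[ℂ[x]_d]_δ` as
  THE `λ`-isotypic projector — and **`cor_5_7_length`** — `X_λ = H_λ Z_λ ∈ U(gl_k)_{≤ (k+1)(δd+1)^k}`
  acting as THE highest-weight projector (typed `(δd+1)` for the printed `(δd)`, the tree's count
  of the weight box as in `cor_5_5`; model `U(T → gl_k)`, `T = (ℝ →ₐ[ℝ] ℂ)`, block `τ₀`).

Not typed: Cor. 5.8's length bound (level-wise Casimirs along `gl_1 ⊂ ⋯ ⊂ gl_k`; the existence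
clause is `cor_5_8_exists`), eq. (9) (Perelomov–Popov values), Thm. 5.10 as printed.

Honest framing: representation-theoretic bookkeeping; nothing here bears on `VP ≠ VNP`.

## References
* [BergEtAl2024] arXiv:2411.03444, §4.3 (length), §4.4, Thm. 4.11 / Thm. 4.13 (p.20, PDF p.21),
  §5.1.2–5.1.3, Cor. 5.6 / Cor. 5.7 (p.27–28, PDF pp.28–29).
* [Knapp2002] A. W. Knapp, *Lie Groups Beyond an Introduction*, Thm. 5.44 (as vendored in
  `HarishChandraGLExistence` / `HarishChandraGLIsomorphism`).
-/

noncomputable section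

-- Mathlib idiom: the commutator bracket on an associative algebra (`T → Matrix (Fin k) (Fin k) ℂ`),
-- as in the imported `BDGIL24CentralCharacters` / `HarishChandraCore`
attribute [local instance 100] LieRing.ofAssociativeRing

open MvPolynomial UniversalEnvelopingAlgebra
open scoped BigOperators

namespace Literature.Barriers.ValiantsHypothesis

namespace BergEtAl2024

open Literature.Computability.AlgebraicComplexity Literature.NumberTheory.DiophantineGeometry

variable {k d : ℕ}

/-! ### [BDGIL24, Thm. 4.11] for the metapolynomial representation: central characters separate
the isotypic components (via the tree's Harish-Chandra isomorphism at `T = (ℝ →ₐ[ℝ] ℂ)`) -/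

section Separation

open Literature.NumberTheory.Automorphic Literature.RingTheory.MvPolynomial.BlockSymmetric

/-- The real sequence `λ + ρ` (`ρ_i = (k-1)/2 - i`, the tree's `rhoGL`) is strictly decreasing for
a dominant `λ`. [cite: BergEtAl2024, §4.4, p.20 (PDF p.21)] -/
theorem strictAnti_shiftedWt {χ : Weight (Fin k)} (hχ : χ.IsDominant) :
    StrictAnti (fun i : Fin k => (χ i : ℝ) + (((k : ℝ) - 1) / 2 - (i : ℕ))) := by
  intro i j hij
  have h1 : (χ j : ℝ) ≤ (χ i : ℝ) := by exact_mod_cast hχ hij.le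
  have h2 : ((i : ℕ) : ℝ) < ((j : ℕ) : ℝ) := by exact_mod_cast hij
  dsimp only
  linarith

/-- In `ℂ`: `λ_i + rhoGL i` is the complexification of the real number `λ_i + (k-1)/2 - i`.
[cite: BergEtAl2024, §4.4, p.20 (PDF p.21)] -/
theorem coe_shiftedWt (χ : Weight (Fin k)) (i : Fin k) :
    (((χ i : ℝ) + (((k : ℝ) - 1) / 2 - (i : ℕ)) : ℝ) : ℂ) = ((χ i : ℤ) : ℂ) + rhoGL k i := by
  simp only [rhoGL]
  push_cast
  ring

/-- **Distinct dominant weights are separated by an elementary symmetric polynomial of `λ + ρ`**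
(the `𝔖_k`-orbits of `λ + ρ` and `μ + ρ` are distinct: strictly decreasing sequences with the same
multiset of entries coincide; the multiset is read off from `∏_i (X + (λ+ρ)_i)`, Vieta).
[cite: BergEtAl2024, Thm. 4.11, p.20 (PDF p.21)] locator: paper:arxiv-2411.03444 p0021.txt:L11–L17 -/
theorem exists_esymm_shiftedWt_ne {χ χ' : Weight (Fin k)} (hχ : χ.IsDominant) (hχ' : χ'.IsDominant)
    (hne : χ ≠ χ') :
    ∃ j ∈ Finset.range (k + 1),
      (Finset.univ.val.map fun i : Fin k => ((χ i : ℤ) : ℂ) + rhoGL k i).esymm j ≠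
        (Finset.univ.val.map fun i : Fin k => ((χ' i : ℤ) : ℂ) + rhoGL k i).esymm j := by
  classical
  by_contra h
  simp only [not_exists, not_and, ne_eq, not_not] at h
  set a : Fin k → ℂ := fun i => ((χ i : ℤ) : ℂ) + rhoGL k i with ha
  set b : Fin k → ℂ := fun i => ((χ' i : ℤ) : ℂ) + rhoGL k i with hb
  -- Vieta: the polynomials `∏ (X + C a_i)` and `∏ (X + C b_i)` coincide
  have hprod : ((Finset.univ.val.map a).map fun r => Polynomial.X + Polynomial.C r).prod =
      ((Finset.univ.val.map b).map fun r => Polynomial.X + Polynomial.C r).prod := by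
    rw [Multiset.prod_X_add_C_eq_sum_esymm, Multiset.prod_X_add_C_eq_sum_esymm,
      Multiset.card_map, Multiset.card_map]
    refine Finset.sum_congr rfl fun j hj => ?_
    rw [Finset.card_val, Finset.card_univ, Fintype.card_fin] at hj ⊢
    rw [h j hj]
  -- hence the multisets of roots `-a_i`, `-b_i` coincide
  have hroots : ∀ f : Fin k → ℂ, ((Finset.univ.val.map f).map fun r => Polynomial.X + Polynomial.C r).prod.roots =
      Finset.univ.val.map fun i => -f i := by
    intro f
    have : ((Finset.univ.val.map f).map fun r => Polynomial.X + Polynomial.C r) =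
        ((Finset.univ.val.map fun i => -f i).map fun r => Polynomial.X - Polynomial.C r) := by
      rw [Multiset.map_map, Multiset.map_map]
      refine Multiset.map_congr rfl fun i _ => ?_
      simp [sub_neg_eq_add]
    rw [this, Polynomial.roots_multiset_prod_X_sub_C]
  have hab : (Finset.univ.val.map fun i => -a i) = Finset.univ.val.map fun i => -b i := by
    rw [← hroots a, ← hroots b, hprod]
  -- so `a` and `b` have the same range; as real strictly decreasing sequences they coincide
  have hrange : Set.range (fun i : Fin k => (χ i : ℝ) + (((k : ℝ) - 1) / 2 - (i : ℕ))) =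
      Set.range (fun i : Fin k => (χ' i : ℝ) + (((k : ℝ) - 1) / 2 - (i : ℕ))) := by
    have key : ∀ x : ℝ, x ∈ Set.range (fun i : Fin k => (χ i : ℝ) + (((k : ℝ) - 1) / 2 - (i : ℕ))) ↔ -((x : ℝ) : ℂ) ∈ Finset.univ.val.map fun i => -a i := by
      intro x
      simp only [Set.mem_range, Multiset.mem_map, Finset.mem_val, Finset.mem_univ, true_and, neg_inj]
      constructor
      · rintro ⟨i, rfl⟩
        exact ⟨i, by rw [ha, coe_shiftedWt]⟩
      · rintro ⟨i, hi⟩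
        refine ⟨i, Complex.ofReal_injective ?_⟩
        rw [coe_shiftedWt, ← hi]
    have key' : ∀ x : ℝ, x ∈ Set.range (fun i : Fin k => (χ' i : ℝ) + (((k : ℝ) - 1) / 2 - (i : ℕ))) ↔ -((x : ℝ) : ℂ) ∈ Finset.univ.val.map fun i => -b i := by
      intro x
      simp only [Set.mem_range, Multiset.mem_map, Finset.mem_val, Finset.mem_univ, true_and, neg_inj]
      constructor
      · rintro ⟨i, rfl⟩
        exact ⟨i, by rw [hb, coe_shiftedWt]⟩
      · rintro ⟨i, hi⟩
        refine ⟨i, Complex.ofReal_injective ?_⟩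
        rw [coe_shiftedWt, ← hi]
    ext x
    rw [key, key', hab]
  have hm : StrictMono ((fun i : Fin k => (χ i : ℝ) + (((k : ℝ) - 1) / 2 - (i : ℕ))) ∘ Fin.rev) :=
    StrictAnti.comp (strictAnti_shiftedWt hχ) Fin.rev_strictAnti
  have hm' : StrictMono ((fun i : Fin k => (χ' i : ℝ) + (((k : ℝ) - 1) / 2 - (i : ℕ))) ∘ Fin.rev) :=
    StrictAnti.comp (strictAnti_shiftedWt hχ') Fin.rev_strictAnti
  have heq : (fun i : Fin k => (χ i : ℝ) + (((k : ℝ) - 1) / 2 - (i : ℕ))) ∘ Fin.rev =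
      (fun i : Fin k => (χ' i : ℝ) + (((k : ℝ) - 1) / 2 - (i : ℕ))) ∘ Fin.rev := by
    refine (hm.range_inj hm').1 ?_
    rw [Fin.rev_involutive.surjective.range_comp, Fin.rev_involutive.surjective.range_comp, hrange]
  apply hne
  funext i
  have hi := congr_fun heq (Fin.rev i)
  simp only [Function.comp_apply, Fin.rev_rev, add_left_inj] at hi
  exact_mod_cast hi

end Separation

section HC

open Literature.NumberTheory.Automorphic Literature.RingTheory.MvPolynomial.BlockSymmetric

/-- Evaluating the block elementary symmetric polynomial `e_j(x_{τ,·})`.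
[cite: BergEtAl2024, §4.4, p.20 (PDF p.21)] -/
theorem aeval_besymm {T : Type*} (f : T × Fin k → ℂ) (τ : T) (j : ℕ) :
    MvPolynomial.aeval f (besymm ℂ τ j : MvPolynomial (T × Fin k) ℂ) =
      (Finset.univ.val.map fun i : Fin k => f (τ, i)).esymm j := by
  rw [besymm, MvPolynomial.aeval_rename, MvPolynomial.aeval_esymm_eq_multiset_esymm]
  rfl

/-- **[BDGIL24, Thm. 4.11] for the metapolynomial representation — central characters separate
the isotypic components.** If `λ ≠ μ` are weights of `gl_k` both occurring as highest weights in
`ℂ[ℂ[x₁,…,x_k]_d]` (nonzero highest weight spaces), there is a central element `z ∈ Z(gl_k)` with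
`χ_λ(z) ≠ χ_μ(z)` ("for Lie algebras `𝔤` of reductive groups central characters separate
non-isomorphic irreducible representations"). Here `gl_k` is realised as the block `τ₀` of the
tree's `𝔤 T k`, `T = (ℝ →ₐ[ℝ] ℂ)` (one real embedding, so `T → gl_k ≅ gl_k`), where the tree's
Harish-Chandra isomorphism lives: `z` is the preimage under the complexified Harish-Chandra
homomorphism (`nonempty_harishChandraHomGL_holds`, `HarishChandraHomGL.complexified_injective_and_range_eq`)
of an elementary symmetric polynomial separating the `𝔖_k`-orbits of `λ + ρ` and `μ + ρ`
(`exists_esymm_shiftedWt_ne`; occurring highest weights are dominant,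
`isDominant_of_mem_highestWeightSpace`), and `z` acts on highest weight vectors by `γ'(z)(λ + ρ)`
(`HarishChandraHomGL.hasHWProperty_complexified`).
[cite: BergEtAl2024, Thm. 4.11, p.20 (PDF p.21)] locator: paper:arxiv-2411.03444 p0021.txt:L11–L17 -/
theorem exists_center_centralChar_ne [DecidableEq (ℝ →ₐ[ℝ] ℂ)] (τ₀ : ℝ →ₐ[ℝ] ℂ)
    {χ χ' : Weight (Fin k)} (hne : χ ≠ χ')
    (hχ : highestWeightSpace (coordRep (Fin k) ℂ d) χ ≠ ⊥)
    (hχ' : highestWeightSpace (coordRep (Fin k) ℂ d) χ' ≠ ⊥) :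
    ∃ z ∈ Subalgebra.center ℂ
        (UniversalEnvelopingAlgebra ℂ ((ℝ →ₐ[ℝ] ℂ) → Matrix (Fin k) (Fin k) ℂ)),
      MvPolynomial.eval (fun p : (ℝ →ₐ[ℝ] ℂ) × Fin k => blockWt τ₀ χ p.1 p.2)
          (HCCore.hcProj (ℝ →ₐ[ℝ] ℂ) k z) ≠
        MvPolynomial.eval (fun p : (ℝ →ₐ[ℝ] ℂ) × Fin k => blockWt τ₀ χ' p.1 p.2)
          (HCCore.hcProj (ℝ →ₐ[ℝ] ℂ) k z) := by
  classical
  -- nonzero highest weight vectors; occurring highest weights are dominant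
  obtain ⟨v, hv, hv0⟩ := (Submodule.ne_bot_iff _).1 hχ
  obtain ⟨v', hv', hv0'⟩ := (Submodule.ne_bot_iff _).1 hχ'
  have hdom : χ.IsDominant :=
    isDominant_of_mem_highestWeightSpace (isRationalRep_coordRep d) hv hv0
  have hdom' : χ'.IsDominant :=
    isDominant_of_mem_highestWeightSpace (isRationalRep_coordRep d) hv' hv0'
  obtain ⟨j, -, hj⟩ := exists_esymm_shiftedWt_ne hdom hdom' hne
  -- a Harish-Chandra homomorphism, complexified: onto the block-symmetric polynomials
  have hγne : Nonempty (HarishChandraHomGL ℝ k) := nonempty_harishChandraHomGL_holds ℝ k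
  obtain ⟨γ⟩ := hγne
  have hmem : (besymm ℂ τ₀ j : MvPolynomial ((ℝ →ₐ[ℝ] ℂ) × Fin k) ℂ) ∈ γ.complexified.range := by
    rw [γ.complexified_injective_and_range_eq.2, symmetricSubalgebraGL_eq_blockSymmetricSubalgebra]
    exact besymm_mem τ₀ j
  obtain ⟨z, hz⟩ := (AlgHom.mem_range _).1 hmem
  refine ⟨z, z.2, ?_⟩
  -- `z` acts on the highest weight vectors by `e_j(λ + ρ)`, `e_j(μ + ρ)` …
  have h1 := γ.hasHWProperty_complexified (MvPolynomial (DegIdx (Fin k) d) ℂ) (lieOpHomGL k d τ₀)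
    (blockWt τ₀ χ) v (isHighestWeightVectorC_of_mem_highestWeightSpace τ₀ hv hv0) z
  have h2 := γ.hasHWProperty_complexified (MvPolynomial (DegIdx (Fin k) d) ℂ) (lieOpHomGL k d τ₀)
    (blockWt τ₀ χ') v' (isHighestWeightVectorC_of_mem_highestWeightSpace τ₀ hv' hv0') z
  -- … and by the central characters `(hcProj z)(λ)`, `(hcProj z)(μ)`
  have e1 := envActGL_center_apply_of_mem_highestWeightSpace (d := d) τ₀ hv z.2
  have e2 := envActGL_center_apply_of_mem_highestWeightSpace (d := d) τ₀ hv' z.2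
  change envActGL k d τ₀ (z : UniversalEnvelopingAlgebra ℂ ((ℝ →ₐ[ℝ] ℂ) → Matrix (Fin k) (Fin k) ℂ)) v = _ at h1
  change envActGL k d τ₀ (z : UniversalEnvelopingAlgebra ℂ ((ℝ →ₐ[ℝ] ℂ) → Matrix (Fin k) (Fin k) ℂ)) v' = _ at h2
  rw [e1, hz, aeval_besymm] at h1
  rw [e2, hz, aeval_besymm] at h2
  have c1 := smul_left_injective ℂ hv0 h1
  have c2 := smul_left_injective ℂ hv0' h2
  simp only [blockWt_self] at c1 c2
  rw [c1, c2]
  exact hj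

/-- **Consequence ([BDGIL24, §4.4]: "the isotypic components of a `𝔤`-representation are also
isotypic components of the induced `Z(𝔤)`-representation")** for `ℂ[ℂ[x₁,…,x_k]_d]`: two distinct
nonzero isotypic components `hwSubrep λ`, `hwSubrep μ` are distinguished by a central element
`z ∈ Z(gl_k)` acting on them by DIFFERENT scalars.
[cite: BergEtAl2024, Thm. 4.11 and §4.4, p.20 (PDF p.21)] locator: paper:arxiv-2411.03444 p0021.txt:L11–L27 -/
theorem exists_center_separates_hwSubrep [DecidableEq (ℝ →ₐ[ℝ] ℂ)] (τ₀ : ℝ →ₐ[ℝ] ℂ)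
    {χ χ' : Weight (Fin k)} (hne : χ ≠ χ')
    (hχ : highestWeightSpace (coordRep (Fin k) ℂ d) χ ≠ ⊥)
    (hχ' : highestWeightSpace (coordRep (Fin k) ℂ d) χ' ≠ ⊥) :
    ∃ z ∈ Subalgebra.center ℂ
        (UniversalEnvelopingAlgebra ℂ ((ℝ →ₐ[ℝ] ℂ) → Matrix (Fin k) (Fin k) ℂ)),
      ∃ c c' : ℂ, c ≠ c' ∧
        (∀ Δ ∈ hwSubrep (coordRep (Fin k) ℂ d) χ, envActGL k d τ₀ z Δ = c • Δ) ∧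
        (∀ Δ ∈ hwSubrep (coordRep (Fin k) ℂ d) χ', envActGL k d τ₀ z Δ = c' • Δ) := by
  obtain ⟨z, hz, hcc⟩ := exists_center_centralChar_ne (d := d) τ₀ hne hχ hχ'
  exact ⟨z, hz, _, _, hcc, fun Δ hΔ => envActGL_center_apply_of_mem_hwSubrep' τ₀ hΔ hz,
    fun Δ hΔ => envActGL_center_apply_of_mem_hwSubrep' τ₀ hΔ hz⟩

end HC

/-! ### Length control: every symmetric polynomial of degree `≤ d` is the Harish-Chandra image of a
polynomial in the Casimir elements of length `≤ d` ([BDGIL24, Thm. 4.13] «the lengths of these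
elements coincide with the degrees of the fundamental invariants») -/

section LengthControl

open Literature.NumberTheory.Automorphic Literature.NumberTheory.Automorphic.HCCore
open Literature.RingTheory.MvPolynomial.BlockSymmetric Literature.Algebra.Lie.PBW
open Literature.Algebra.Lie.ChevalleyGL

variable {T : Type*} [Fintype T] [DecidableEq T] {n : ℕ}

attribute [local instance] Literature.NumberTheory.Automorphic.HCCore.idxLinearOrder

/-- The central Casimir polynomial `G(C_{τ,k+1})` (`HCCore.zOfPoly`) of a polynomial `G` weighted
homogeneous of weight `d` has length `≤ d` (lies in `U(𝔤)_{≤d}`) and restricted top symbol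
`G(p_{k+1}(x_{τ,·}))` — the explicit witness of `HCCore.exists_center_lift`.
[cite: BergEtAl2024, Thm. 4.13, p.20 (PDF p.21)] locator: paper:arxiv-2411.03444 p0021.txt:L48–L53 -/
theorem zOfPoly_mem_fil_and_symb {G : MvPolynomial (T × Fin n) ℂ} {d : ℕ}
    (hG : IsWeightedHomogeneous (blockWeight T n) G d) :
    ((zOfPoly T n G : Subalgebra.center ℂ (UniversalEnvelopingAlgebra ℂ (𝔤 T n))) :
        UniversalEnvelopingAlgebra ℂ (𝔤 T n)) ∈ fil (stdB T n) d ∧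
      restrictDiag T n ℂ (symb (stdB T n) d
        ((zOfPoly T n G : Subalgebra.center ℂ (UniversalEnvelopingAlgebra ℂ (𝔤 T n))) :
          UniversalEnvelopingAlgebra ℂ (𝔤 T n))) = blockPsumAeval T n ℂ G := by
  classical
  have hG' : ((zOfPoly T n G : Subalgebra.center ℂ (UniversalEnvelopingAlgebra ℂ (𝔤 T n))) :
      UniversalEnvelopingAlgebra ℂ (𝔤 T n)) =
      ∑ m ∈ G.support, coeff m G • ((zOfPoly T n (monomial m 1) :
        Subalgebra.center ℂ (UniversalEnvelopingAlgebra ℂ (𝔤 T n))) : UniversalEnvelopingAlgebra ℂ (𝔤 T n)) := by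
    conv_lhs => rw [← G.support_sum_monomial_coeff, map_sum]
    rw [AddSubmonoidClass.coe_finsetSum]
    refine Finset.sum_congr rfl fun m _ => ?_
    rw [show monomial m (coeff m G) = coeff m G • monomial m 1 by
      rw [smul_monomial, smul_eq_mul, mul_one], map_smul, Subalgebra.coe_smul]
  constructor
  · rw [hG']
    refine Submodule.sum_mem _ fun m hm => Submodule.smul_mem _ _ ?_
    rw [← hG (mem_support_iff.mp hm)]
    exact (zOfPoly_monomial m).1
  · rw [hG', map_sum, map_sum]
    conv_rhs => rw [← G.support_sum_monomial_coeff, map_sum]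
    refine Finset.sum_congr rfl fun m hm => ?_
    rw [map_smul, map_smul, ← hG (mem_support_iff.mp hm), (zOfPoly_monomial m).2,
      show monomial m (coeff m G) = coeff m G • monomial m 1 by
        rw [smul_monomial, smul_eq_mul, mul_one], map_smul]

/-- The `γ'`-image of the Casimir polynomial `G(C_{τ,k+1})` for `G` weighted homogeneous of weight
`d`: total degree `≤ d` and top homogeneous component `G(p_{k+1}(x_{τ,·}))` (explicit-witness form
of `HCCore.exists_gamma_top`). [cite: BergEtAl2024, Thm. 4.13, p.20 (PDF p.21)] -/
theorem gamma_zOfPoly_top {c : T × Fin n → ℂ}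
    {γ' : Subalgebra.center ℂ (UniversalEnvelopingAlgebra ℂ (𝔤 T n)) →ₐ[ℂ] MvPolynomial (T × Fin n) ℂ}
    (hγ : HasHWProperty c γ') {G : MvPolynomial (T × Fin n) ℂ} {d : ℕ}
    (hG : IsWeightedHomogeneous (blockWeight T n) G d) :
    (γ' (zOfPoly T n G)).totalDegree ≤ d ∧
      homogeneousComponent d (γ' (zOfPoly T n G)) = blockPsumAeval T n ℂ G := by
  obtain ⟨hzf, hzs⟩ := zOfPoly_mem_fil_and_symb hG
  rw [eq_shiftPoly_hcProj hγ]
  have h := totalDegree_shiftPoly_le_and_homogeneousComponent_eq c (totalDegree_hcProj_le hzf)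
  refine ⟨h.1, ?_⟩
  rw [h.2]
  show homogeneousComponent d (hcProj T n _) = _
  rw [homogeneousComponent_hcProj, hzs]

/-- **Harish-Chandra surjectivity WITH LENGTH CONTROL** ([BDGIL24, Thm. 4.13]: "`Z(𝔤) = ℂ[C₁,…,C_k]`.
The lengths of these elements coincide with the degrees of the fundamental invariants"): if `γ'`
has the highest weight property and symmetric values, every block-symmetric polynomial `f` of
total degree `≤ d` is `γ'(z)` for a central `z` of length `≤ d` (`z ∈ U(𝔤)_{≤d}`), indeed a
polynomial in the Casimir elements — the induction of `HCCore.exists_eq_gamma_of_mem` with the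
witnesses kept explicit.
[cite: BergEtAl2024, Thm. 4.13, p.20 (PDF p.21)] locator: paper:arxiv-2411.03444 p0021.txt:L48–L53 -/
theorem exists_center_fil_gamma_eq {c : T × Fin n → ℂ}
    {γ' : Subalgebra.center ℂ (UniversalEnvelopingAlgebra ℂ (𝔤 T n)) →ₐ[ℂ] MvPolynomial (T × Fin n) ℂ}
    (hγ : HasHWProperty c γ') (hsym : ∀ z, γ' z ∈ blockSymmetricSubalgebra T n ℂ) (d : ℕ) :
    ∀ f ∈ blockSymmetricSubalgebra T n ℂ, f.totalDegree ≤ d →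
      ∃ z : Subalgebra.center ℂ (UniversalEnvelopingAlgebra ℂ (𝔤 T n)),
        (z : UniversalEnvelopingAlgebra ℂ (𝔤 T n)) ∈ fil (stdB T n) d ∧ γ' z = f := by
  induction d with
  | zero =>
    intro f hf hd
    obtain ⟨G, hG, hGf⟩ := exists_isWeightedHomogeneous_blockPsumAeval_eq T n hf
      ((totalDegree_zero_iff_isHomogeneous _).mp (Nat.le_zero.mp hd))
    obtain ⟨hz1, hz2⟩ := gamma_zOfPoly_top hγ hG
    refine ⟨zOfPoly T n G, (zOfPoly_mem_fil_and_symb hG).1, ?_⟩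
    rw [← homogeneousComponent_eq_self ((totalDegree_zero_iff_isHomogeneous _).mp (Nat.le_zero.mp hz1)),
      hz2, hGf]
  | succ d ih =>
    intro f hf hd
    have hfd := homogeneousComponent_mem_blockSymmetricSubalgebra hf (d + 1)
    obtain ⟨G, hG, hGf⟩ := exists_isWeightedHomogeneous_blockPsumAeval_eq T n hfd
      (homogeneousComponent_isHomogeneous (d + 1) f)
    obtain ⟨hz1, hz2⟩ := gamma_zOfPoly_top hγ hG
    have hg : f - γ' (zOfPoly T n G) ∈ blockSymmetricSubalgebra T n ℂ := Subalgebra.sub_mem _ hf (hsym _)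
    have hgd : (f - γ' (zOfPoly T n G)).totalDegree ≤ d := by
      refine totalDegree_le_of_homogeneousComponent_eq_zero ?_ ?_
      · exact (totalDegree_sub _ _).trans (max_le hd hz1)
      · rw [map_sub, hz2, hGf, sub_self]
    obtain ⟨z', hz'f, hz'⟩ := ih _ hg hgd
    refine ⟨z' + zOfPoly T n G, ?_, ?_⟩
    · rw [Subalgebra.coe_add]
      exact Submodule.add_mem _ (fil_mono (stdB T n) (Nat.le_succ d) hz'f) (zOfPoly_mem_fil_and_symb hG).1
    · rw [map_add, hz', sub_add_cancel]

end LengthControl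

section SeparationLength

open Literature.NumberTheory.Automorphic Literature.RingTheory.MvPolynomial.BlockSymmetric
open Literature.Algebra.Lie.PBW

attribute [local instance] Literature.NumberTheory.Automorphic.HCCore.idxLinearOrder

/-- **Thm. 4.11 with length control**: in the situation of `exists_center_centralChar_ne` the
separating central element can be taken of length `≤ k` (`z ∈ U(gl_k)_{≤k}`), indeed a polynomial
in the Casimir elements: the separating elementary symmetric polynomial `e_j`, `j ≤ k`, is the
Harish-Chandra image of such an element (`exists_center_fil_gamma_eq`). This is the input of the
printed length bound of [BDGIL24, Cor. 5.6] ("For the chain … Casimir elements have length at most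
`k`"). [cite: BergEtAl2024, Thm. 4.11 and Thm. 4.13, p.20 (PDF p.21)] locator: paper:arxiv-2411.03444 p0021.txt:L11–L17, L48–L53 -/
theorem exists_center_fil_centralChar_ne [DecidableEq (ℝ →ₐ[ℝ] ℂ)] (τ₀ : ℝ →ₐ[ℝ] ℂ)
    {χ χ' : Weight (Fin k)} (hne : χ ≠ χ')
    (hχ : highestWeightSpace (coordRep (Fin k) ℂ d) χ ≠ ⊥)
    (hχ' : highestWeightSpace (coordRep (Fin k) ℂ d) χ' ≠ ⊥) :
    ∃ z ∈ Subalgebra.center ℂ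
        (UniversalEnvelopingAlgebra ℂ ((ℝ →ₐ[ℝ] ℂ) → Matrix (Fin k) (Fin k) ℂ)),
      z ∈ fil (HCCore.stdB (ℝ →ₐ[ℝ] ℂ) k) k ∧
      MvPolynomial.eval (fun p : (ℝ →ₐ[ℝ] ℂ) × Fin k => blockWt τ₀ χ p.1 p.2)
          (HCCore.hcProj (ℝ →ₐ[ℝ] ℂ) k z) ≠
        MvPolynomial.eval (fun p : (ℝ →ₐ[ℝ] ℂ) × Fin k => blockWt τ₀ χ' p.1 p.2)
          (HCCore.hcProj (ℝ →ₐ[ℝ] ℂ) k z) := by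
  classical
  obtain ⟨v, hv, hv0⟩ := (Submodule.ne_bot_iff _).1 hχ
  obtain ⟨v', hv', hv0'⟩ := (Submodule.ne_bot_iff _).1 hχ'
  have hdom : χ.IsDominant :=
    isDominant_of_mem_highestWeightSpace (isRationalRep_coordRep d) hv hv0
  have hdom' : χ'.IsDominant :=
    isDominant_of_mem_highestWeightSpace (isRationalRep_coordRep d) hv' hv0'
  obtain ⟨j, hj', hj⟩ := exists_esymm_shiftedWt_ne hdom hdom' hne
  have hγne : Nonempty (HarishChandraHomGL ℝ k) := nonempty_harishChandraHomGL_holds ℝ k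
  obtain ⟨γ⟩ := hγne
  -- `e_j` (degree `j ≤ k`) is the image of a central element of length `≤ k`
  have hdeg : (besymm ℂ τ₀ j : MvPolynomial ((ℝ →ₐ[ℝ] ℂ) × Fin k) ℂ).totalDegree ≤ k :=
    (besymm_isHomogeneous (R := ℂ) (n := k) τ₀ j).totalDegree_le.trans
      (by have := Finset.mem_range.1 hj'; omega)
  obtain ⟨z, hzfil, hz⟩ := exists_center_fil_gamma_eq γ.hasHWProperty_complexified
    γ.complexified_mem k _ (besymm_mem τ₀ j) hdeg
  refine ⟨z, z.2, hzfil, ?_⟩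
  have h1 := γ.hasHWProperty_complexified (MvPolynomial (DegIdx (Fin k) d) ℂ) (lieOpHomGL k d τ₀)
    (blockWt τ₀ χ) v (isHighestWeightVectorC_of_mem_highestWeightSpace τ₀ hv hv0) z
  have h2 := γ.hasHWProperty_complexified (MvPolynomial (DegIdx (Fin k) d) ℂ) (lieOpHomGL k d τ₀)
    (blockWt τ₀ χ') v' (isHighestWeightVectorC_of_mem_highestWeightSpace τ₀ hv' hv0') z
  have e1 := envActGL_center_apply_of_mem_highestWeightSpace (d := d) τ₀ hv z.2
  have e2 := envActGL_center_apply_of_mem_highestWeightSpace (d := d) τ₀ hv' z.2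
  change envActGL k d τ₀ (z : UniversalEnvelopingAlgebra ℂ ((ℝ →ₐ[ℝ] ℂ) → Matrix (Fin k) (Fin k) ℂ)) v = _ at h1
  change envActGL k d τ₀ (z : UniversalEnvelopingAlgebra ℂ ((ℝ →ₐ[ℝ] ℂ) → Matrix (Fin k) (Fin k) ℂ)) v' = _ at h2
  rw [e1, hz, aeval_besymm] at h1
  rw [e2, hz, aeval_besymm] at h2
  have c1 := smul_left_injective ℂ hv0 h1
  have c2 := smul_left_injective ℂ hv0' h2
  simp only [blockWt_self] at c1 c2
  rw [c1, c2]
  exact hj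

end SeparationLength

/-! ### [BDGIL24, Cor. 5.6] WITH ITS LENGTH BOUND: the isotypic projector as a polynomial in
bounded-length central elements (Thm. 5.2 over `Z(gl_k)`) -/

section Cor56Length

open Literature.NumberTheory.Automorphic Literature.RingTheory.MvPolynomial.BlockSymmetric
open Literature.Algebra.Lie.PBW

attribute [local instance] Literature.NumberTheory.Automorphic.HCCore.idxLinearOrder

/-- A nonzero element of an isotypic component forces a nonzero highest weight vector.
[cite: GoodmanWallachGTM255, §4.1.6 (isotypic decomposition)] -/
theorem highestWeightSpace_ne_bot_of_mem_hwSubrep {K V σ : Type*} [Field K] [AddCommGroup V]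
    [Module K V] [Fintype σ] [LinearOrder σ] {ρ : Representation K (GL σ K) V}
    {μ : Weight σ} {x : V} (hx : x ∈ hwSubrep ρ μ) (hx0 : x ≠ 0) :
    highestWeightSpace ρ μ ≠ ⊥ := by
  intro hbot
  apply hx0
  have hle : hwSubrep ρ μ ≤ ⊥ := by
    unfold hwSubrep
    refine Submodule.span_le.2 ?_
    rintro _ ⟨g, v, hv, rfl⟩
    rw [hbot, Submodule.mem_bot] at hv
    rw [hv, map_zero]
    exact Submodule.zero_mem _
  exact (Submodule.mem_bot K).1 (hle hx)

/-- A highest weight occurring in the isotypic decomposition of the degree-`δ` metapolynomials lies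
in the weight box and has a nonzero highest weight vector. [cite: BergEtAl2024, §5.1.2, p.27 (PDF p.28)] -/
theorem mem_weightBox_of_mem_hwSubrep {δ : ℕ} {μ : Weight (Fin k)}
    {x : MvPolynomial (DegIdx (Fin k) d) ℂ} (hx : x.IsHomogeneous δ)
    (hxμ : x ∈ hwSubrep (coordRep (Fin k) ℂ d) μ) (hx0 : x ≠ 0) :
    μ ∈ weightBox k d δ ∧ highestWeightSpace (coordRep (Fin k) ℂ d) μ ≠ ⊥ := by
  classical
  have hspan := mem_span_translates_homogeneous_of_mem_hwSubrep hx hxμ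
  -- some homogeneous highest weight vector of weight `μ` is nonzero
  by_contra hcon
  apply hx0
  have hle : Submodule.span ℂ {z | ∃ (g : GL (Fin k) ℂ) (v : MvPolynomial (DegIdx (Fin k) d) ℂ),
      v ∈ homogeneousSubmodule (DegIdx (Fin k) d) ℂ δ ∧
        v ∈ highestWeightSpace (coordRep (Fin k) ℂ d) μ ∧ z = coordRep (Fin k) ℂ d g v} ≤ ⊥ := by
    refine Submodule.span_le.2 ?_
    rintro _ ⟨g, v, hvδ, hvμ, rfl⟩
    rw [SetLike.mem_coe, Submodule.mem_bot]
    by_cases hv0 : v = 0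
    · rw [hv0, map_zero]
    · exfalso
      apply hcon
      refine ⟨?_, fun hbot => hv0 ((Submodule.mem_bot ℂ).1 (hbot ▸ hvμ))⟩
      by_contra hbox
      apply hv0
      have hvw : v ∈ weightSpace (coordRep (Fin k) ℂ d) μ := highestWeightSpace_le_weightSpace _ _ hvμ
      rw [eq_weightPart_of_mem_weightSpace hvw, ← weightedHomogeneousComponent_eq_weightPart]
      exact weightedHomogeneousComponent_eq_zero_of_not_mem ((mem_homogeneousSubmodule δ v).1 hvδ) hbox
  exact (Submodule.mem_bot ℂ).1 (hle hspan)

/-- A scalar multiple of `u − a·1`, `u ∈ U(𝔤)_{≤m}`, has length `≤ m`.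
[cite: BergEtAl2024, §4.3, p.19 (PDF p.20)] locator: paper:arxiv-2411.03444 p0020.txt:L17–L24 -/
theorem smul_sub_algebraMap_mem_fil {T : Type*} [Fintype T] [DecidableEq T] {m : ℕ}
    {u : UniversalEnvelopingAlgebra ℂ (T → Matrix (Fin k) (Fin k) ℂ)}
    (hu : u ∈ fil (HCCore.stdB T k) m) (c a : ℂ) :
    c • (u - algebraMap ℂ (UniversalEnvelopingAlgebra ℂ (T → Matrix (Fin k) (Fin k) ℂ)) a) ∈
      fil (HCCore.stdB T k) m := by
  refine Submodule.smul_mem _ c (Submodule.sub_mem _ hu ?_)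
  rw [Algebra.algebraMap_eq_smul_one]
  exact Submodule.smul_mem _ a (fil_mono (HCCore.stdB T k) (Nat.zero_le m) one_mem_fil_zero)

/-- A product of `r` elements of length `≤ m` has length `≤ r·m`.
[cite: BergEtAl2024, §4.3, p.19 (PDF p.20)] locator: paper:arxiv-2411.03444 p0020.txt:L17–L21 -/
theorem list_prod_mem_fil_mul {T : Type*} [Fintype T] [DecidableEq T] {m : ℕ}
    {l : List (UniversalEnvelopingAlgebra ℂ (T → Matrix (Fin k) (Fin k) ℂ))}
    (hl : ∀ x ∈ l, x ∈ fil (HCCore.stdB T k) m) : l.prod ∈ fil (HCCore.stdB T k) (l.length * m) := by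
  induction l with
  | nil =>
    rw [List.prod_nil, List.length_nil, zero_mul]
    exact one_mem_fil_zero
  | cons x l ih =>
    rw [List.prod_cons, List.length_cons, Nat.succ_mul, add_comm]
    exact mul_mem_fil (HCCore.stdB T k) (hl x (List.mem_cons.2 (Or.inl rfl)))
      (ih fun y hy => hl y (List.mem_cons.2 (Or.inr hy)))

/-- The central character of an occurring highest weight `μ`, computed through a Harish-Chandra
homomorphism: `χ_μ(z) = γ'(z)(μ + ρ)`. [cite: BergEtAl2024, §4.4, p.20 (PDF p.21)] -/
theorem eval_hcProj_eq_aeval_complexified [DecidableEq (ℝ →ₐ[ℝ] ℂ)] (τ₀ : ℝ →ₐ[ℝ] ℂ)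
    (γ : HarishChandraHomGL ℝ k) {μ : Weight (Fin k)}
    (hμ : highestWeightSpace (coordRep (Fin k) ℂ d) μ ≠ ⊥)
    (z : Subalgebra.center ℂ (UniversalEnvelopingAlgebra ℂ ((ℝ →ₐ[ℝ] ℂ) → Matrix (Fin k) (Fin k) ℂ))) :
    MvPolynomial.eval (fun p : (ℝ →ₐ[ℝ] ℂ) × Fin k => blockWt τ₀ μ p.1 p.2)
        (HCCore.hcProj (ℝ →ₐ[ℝ] ℂ) k z) =
      MvPolynomial.aeval (fun p : (ℝ →ₐ[ℝ] ℂ) × Fin k => blockWt τ₀ μ p.1 p.2 + rhoGL k p.2)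
        (γ.complexified z) := by
  obtain ⟨v, hv, hv0⟩ := (Submodule.ne_bot_iff _).1 hμ
  have h1 := γ.hasHWProperty_complexified (MvPolynomial (DegIdx (Fin k) d) ℂ) (lieOpHomGL k d τ₀)
    (blockWt τ₀ μ) v (isHighestWeightVectorC_of_mem_highestWeightSpace τ₀ hv hv0) z
  have e1 := envActGL_center_apply_of_mem_highestWeightSpace (d := d) τ₀ hv z.2
  change envActGL k d τ₀ (z : UniversalEnvelopingAlgebra ℂ ((ℝ →ₐ[ℝ] ℂ) → Matrix (Fin k) (Fin k) ℂ)) v = _ at h1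
  rw [e1] at h1
  exact smul_left_injective ℂ hv0 h1

/-- **[BDGIL24, Cor. 5.6] with its LENGTH bound** ("there is an element `Z_λ ∈ U(gl_k)` of length
at most `k(δd)^k` which acts on `ℂ[ℂ[x₁,…,x_k]_d]_δ` as the projector onto the isotypic component
corresponding to `λ`"), following the PRINTED proof: `Z(gl_k)` acts on the `μ`-isotypic component
by the central character (`envActGL_center_apply_of_mem_hwSubrep'`), the central characters of
distinct occurring (dominant) highest weights are separated by central elements `z₁,…,z_k` of
length `≤ k` whose Harish-Chandra images are the elementary symmetric polynomials
(`exists_center_fil_gamma_eq`, `exists_esymm_shiftedWt_ne`; "Casimir elements have length at most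
`k`"), and Thm. 5.2 (`thm_5_2_linearFactors`) builds the projector as an ordered product of
`≤ |Λ| − 1` affine factors in the `z_j`, `|Λ| ≤ (δd+1)^k + 1`. Typed length bound `k(δd+1)^k`
(the tree's count of the weight box, as in `cor_5_5`; printed `k(δd)^k`). Model: `U(T → gl_k)`,
`T = (ℝ →ₐ[ℝ] ℂ)` (one embedding), block `τ₀`, where the tree's Harish-Chandra isomorphism lives.
[cite: BergEtAl2024, Cor. 5.6, p.27 (PDF p.28)] locator: paper:arxiv-2411.03444 p0028.txt:L28–L43 -/
theorem cor_5_6_length [DecidableEq (ℝ →ₐ[ℝ] ℂ)] (τ₀ : ℝ →ₐ[ℝ] ℂ) (δ : ℕ) (χ : Weight (Fin k)) :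
    ∃ Z : UniversalEnvelopingAlgebra ℂ ((ℝ →ₐ[ℝ] ℂ) → Matrix (Fin k) (Fin k) ℂ),
      Z ∈ fil (HCCore.stdB (ℝ →ₐ[ℝ] ℂ) k) (k * (δ * d + 1) ^ k) ∧
        ∀ Δ : MvPolynomial (DegIdx (Fin k) d) ℂ, Δ.IsHomogeneous δ →
          envActGL k d τ₀ Z Δ ∈ hwSubrep (coordRep (Fin k) ℂ d) χ ∧
            Δ - envActGL k d τ₀ Z Δ ∈
              ⨆ χ' ∈ {χ' : Weight (Fin k) | χ' ≠ χ}, hwSubrep (coordRep (Fin k) ℂ d) χ' := by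
  classical
  -- the degree-`δ` part and its isotypic decomposition
  set W : Submodule ℂ (MvPolynomial (DegIdx (Fin k) d) ℂ) :=
    homogeneousSubmodule (DegIdx (Fin k) d) ℂ δ with hW
  haveI : FiniteDimensional ℂ W :=
    Module.Finite.iff_fg.mpr (homogeneousSubmodule_fg (DegIdx (Fin k) d) ℂ δ)
  have hWstab : ∀ g, W ≤ W.comap (coordRep (Fin k) ℂ d g) := fun g x hx =>
    (mem_homogeneousSubmodule δ _).2 (isHomogeneous_coordSubst g ((mem_homogeneousSubmodule δ _).1 hx))
  have hdec : ∀ Δ : MvPolynomial (DegIdx (Fin k) d) ℂ, Δ.IsHomogeneous δ →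
      Δ ∈ ⨆ μ : Weight (Fin k), W ⊓ hwSubrep (coordRep (Fin k) ℂ d) μ := fun Δ hΔ =>
    le_iSup_inf_hwSubrep (isRationalRep_coordRep d) W hWstab ((mem_homogeneousSubmodule δ Δ).2 hΔ)
  by_cases hχ : highestWeightSpace (coordRep (Fin k) ℂ d) χ = ⊥
  · -- `λ` does not occur: the projector is `0`
    refine ⟨0, Submodule.zero_mem _, fun Δ hΔ => ?_⟩
    rw [map_zero, LinearMap.zero_apply, sub_zero]
    refine ⟨Submodule.zero_mem _, ?_⟩
    refine Submodule.iSup_induction (fun μ => W ⊓ hwSubrep (coordRep (Fin k) ℂ d) μ)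
      (motive := fun x => x ∈ ⨆ χ' ∈ {χ' : Weight (Fin k) | χ' ≠ χ},
        hwSubrep (coordRep (Fin k) ℂ d) χ') (hdec Δ hΔ) ?_ (Submodule.zero_mem _)
      (fun x y hx hy => Submodule.add_mem _ hx hy)
    rintro μ x ⟨-, hxμ⟩
    by_cases hμχ : μ = χ
    · subst hμχ
      by_cases hx0 : x = 0
      · rw [hx0]; exact Submodule.zero_mem _
      · exact absurd hχ (highestWeightSpace_ne_bot_of_mem_hwSubrep hxμ hx0)
    · exact Submodule.mem_iSup_of_mem μ (Submodule.mem_iSup_of_mem hμχ hxμ)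
  -- `λ` occurs. Bounded-length central elements with Harish-Chandra images `e_1, …, e_k`
  have hγne : Nonempty (HarishChandraHomGL ℝ k) := nonempty_harishChandraHomGL_holds ℝ k
  obtain ⟨γ⟩ := hγne
  have hz : ∀ j : Fin k, ∃ z : Subalgebra.center ℂ
      (UniversalEnvelopingAlgebra ℂ ((ℝ →ₐ[ℝ] ℂ) → Matrix (Fin k) (Fin k) ℂ)),
      (z : UniversalEnvelopingAlgebra ℂ ((ℝ →ₐ[ℝ] ℂ) → Matrix (Fin k) (Fin k) ℂ)) ∈
          fil (HCCore.stdB (ℝ →ₐ[ℝ] ℂ) k) k ∧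
        γ.complexified z = besymm ℂ τ₀ ((j : ℕ) + 1) := fun j =>
    exists_center_fil_gamma_eq γ.hasHWProperty_complexified γ.complexified_mem k _ (besymm_mem τ₀ _)
      ((besymm_isHomogeneous (R := ℂ) (n := k) τ₀ ((j : ℕ) + 1)).totalDegree_le.trans (by omega))
  choose z hzfil hzγ using hz
  -- the eigenvalue tuples `(e_{j+1}(μ + ρ))_j`
  let l : Weight (Fin k) → (Fin k → ℂ) := fun μ j =>
    (Finset.univ.val.map fun i : Fin k => ((μ i : ℤ) : ℂ) + rhoGL k i).esymm ((j : ℕ) + 1)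
  -- `z_j` acts on the `μ`-isotypic component by `l μ j`
  have heig : ∀ μ : Weight (Fin k), highestWeightSpace (coordRep (Fin k) ℂ d) μ ≠ ⊥ →
      ∀ x ∈ hwSubrep (coordRep (Fin k) ℂ d) μ, ∀ j : Fin k,
        envActGL k d τ₀ (z j) x = l μ j • x := by
    intro μ hμ x hx j
    rw [envActGL_center_apply_of_mem_hwSubrep' τ₀ hx (z j).2,
      eval_hcProj_eq_aeval_complexified (d := d) τ₀ γ hμ, hzγ, aeval_besymm]
    simp only [blockWt_self]
    rfl
  -- separation of the tuples of distinct occurring weights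
  have hsep : ∀ μ : Weight (Fin k), highestWeightSpace (coordRep (Fin k) ℂ d) μ ≠ ⊥ → μ ≠ χ →
      l μ ≠ l χ := by
    intro μ hμ hμχ hl
    obtain ⟨v, hv, hv0⟩ := (Submodule.ne_bot_iff _).1 hμ
    obtain ⟨w, hw, hw0⟩ := (Submodule.ne_bot_iff _).1 hχ
    obtain ⟨j, hj, hne⟩ := exists_esymm_shiftedWt_ne
      (isDominant_of_mem_highestWeightSpace (isRationalRep_coordRep d) hv hv0)
      (isDominant_of_mem_highestWeightSpace (isRationalRep_coordRep d) hw hw0) hμχ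
    -- `j ≠ 0` (the `0`-th elementary symmetric polynomial is `1`), so `j = j' + 1`, `j' < k`
    obtain ⟨j', rfl⟩ : ∃ j', j = j' + 1 := by
      refine Nat.exists_eq_add_one.2 (Nat.pos_of_ne_zero fun h0 => hne ?_)
      subst h0
      rw [Multiset.esymm, Multiset.esymm, Multiset.powersetCard_zero_left, Multiset.powersetCard_zero_left]
    have hj' : j' < k := by have := Finset.mem_range.1 hj; omega
    exact hne (congr_fun hl ⟨j', hj'⟩)
  -- Thm. 5.2 over the commuting family `z_1, …, z_k`
  set Λ : Finset (Fin k → ℂ) := insert (l χ) ((weightBox k d δ).image l) with hΛ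
  obtain ⟨L, hLlen, hLid, hLzero⟩ := thm_5_2_linearFactors
    (fun j : Fin k => envActGL k d τ₀ (z j)) Λ (l := l χ) (Finset.mem_insert_self _ _)
  -- the same ordered product inside `U(gl_k)`
  let f : Fin k × ℂ × ℂ → UniversalEnvelopingAlgebra ℂ ((ℝ →ₐ[ℝ] ℂ) → Matrix (Fin k) (Fin k) ℂ) :=
    fun t => t.2.1 • ((z t.1 : UniversalEnvelopingAlgebra ℂ ((ℝ →ₐ[ℝ] ℂ) → Matrix (Fin k) (Fin k) ℂ)) -
      algebraMap ℂ _ t.2.2)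
  have hprod : envActGL k d τ₀ (L.map f).prod =
      (L.map fun t => t.2.1 • (envActGL k d τ₀ (z t.1) -
        algebraMap ℂ (Module.End ℂ (MvPolynomial (DegIdx (Fin k) d) ℂ)) t.2.2)).prod := by
    rw [map_list_prod, List.map_map]
    congr 1
    refine List.map_congr_left fun t _ => ?_
    rw [Function.comp_apply, map_smul, map_sub, AlgHom.commutes]
  refine ⟨(L.map f).prod, ?_, fun Δ hΔ => ?_⟩
  · -- length: `≤ |L| · k ≤ (δd+1)^k · k`
    have hmem := list_prod_mem_fil_mul (k := k) (m := k) (l := L.map f) fun x hx => by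
      obtain ⟨t, -, rfl⟩ := List.mem_map.1 hx
      exact smul_sub_algebraMap_mem_fil (hzfil t.1) _ _
    rw [List.length_map] at hmem
    refine fil_mono (HCCore.stdB (ℝ →ₐ[ℝ] ℂ) k) ?_ hmem
    have hcard : Λ.card ≤ (δ * d + 1) ^ k + 1 :=
      (Finset.card_insert_le _ _).trans (Nat.add_le_add_right
        (Finset.card_image_le.trans (card_weightBox_le k d δ)) 1)
    have hL : L.length ≤ (δ * d + 1) ^ k := by omega
    calc L.length * k ≤ (δ * d + 1) ^ k * k := Nat.mul_le_mul_right k hL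
      _ = k * (δ * d + 1) ^ k := Nat.mul_comm _ _
  · rw [hprod]
    refine Submodule.iSup_induction (fun μ => W ⊓ hwSubrep (coordRep (Fin k) ℂ d) μ)
      (motive := fun x =>
        (L.map fun t => t.2.1 • (envActGL k d τ₀ (z t.1) -
          algebraMap ℂ (Module.End ℂ (MvPolynomial (DegIdx (Fin k) d) ℂ)) t.2.2)).prod x ∈
            hwSubrep (coordRep (Fin k) ℂ d) χ ∧
        x - (L.map fun t => t.2.1 • (envActGL k d τ₀ (z t.1) -
          algebraMap ℂ (Module.End ℂ (MvPolynomial (DegIdx (Fin k) d) ℂ)) t.2.2)).prod x ∈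
            ⨆ χ' ∈ {χ' : Weight (Fin k) | χ' ≠ χ}, hwSubrep (coordRep (Fin k) ℂ d) χ')
      (hdec Δ hΔ) ?_ ?_ ?_
    · rintro μ x ⟨hxW, hxμ⟩
      by_cases hx0 : x = 0
      · rw [hx0, map_zero, sub_zero]
        exact ⟨Submodule.zero_mem _, Submodule.zero_mem _⟩
      obtain ⟨hμbox, hμ⟩ := mem_weightBox_of_mem_hwSubrep ((mem_homogeneousSubmodule δ x).1 hxW) hxμ hx0
      by_cases hμχ : μ = χ
      · subst hμχ
        rw [hLid x (fun j => heig _ hμ x hxμ j), sub_self]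
        exact ⟨hxμ, Submodule.zero_mem _⟩
      · rw [hLzero (l μ) (Finset.mem_insert_of_mem (Finset.mem_image_of_mem l hμbox)) (hsep μ hμ hμχ)
          x (fun j => heig μ hμ x hxμ j), sub_zero]
        exact ⟨Submodule.zero_mem _, Submodule.mem_iSup_of_mem μ (Submodule.mem_iSup_of_mem hμχ hxμ)⟩
    · rw [map_zero, sub_zero]
      exact ⟨Submodule.zero_mem _, Submodule.zero_mem _⟩
    · rintro x y ⟨hx, hx'⟩ ⟨hy, hy'⟩
      rw [map_add, add_sub_add_comm]
      exact ⟨Submodule.add_mem _ hx hy, Submodule.add_mem _ hx' hy'⟩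

end Cor56Length

/-! ### [BDGIL24, Cor. 5.7] WITH ITS LENGTH BOUND: `X_λ = H_λ Z_λ` -/

section Cor57Length

open Literature.NumberTheory.Automorphic Literature.RingTheory.MvPolynomial.BlockSymmetric
open Literature.Algebra.Lie.PBW

attribute [local instance] Literature.NumberTheory.Automorphic.HCCore.idxLinearOrder

/-- **[BDGIL24, Cor. 5.7] with its LENGTH bound** ("there is an element `X_λ = H_λ Z_λ ∈ U(gl_k)`
of length at most `(k+1)(δd)^k` which acts on `ℂ[ℂ[x₁,…,x_k]_d]_δ` as the projector onto the highest
weight space of weight `λ`"): `X = H Z` with `H` the weight projector of Cor. 5.5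
(`cor_5_5_length`, length `≤ (δd+1)^k`) and `Z` the isotypic projector of Cor. 5.6
(`cor_5_6_length`, length `≤ k(δd+1)^k`), of length `≤ (k+1)(δd+1)^k` by multiplicativity of the
filtration (`mul_mem_fil`); it acts on degree-`δ` metapolynomials as THE highest-weight projector
(characterisation of `thm_1_1_hwv`). Typed `(δd+1)` for the printed `(δd)` as in `cor_5_5`.
[cite: BergEtAl2024, Cor. 5.7, p.28 (PDF p.29)] locator: paper:arxiv-2411.03444 p0028.txt:L44–L47, p0029.txt:L1–L3 -/
theorem cor_5_7_length [DecidableEq (ℝ →ₐ[ℝ] ℂ)] (τ₀ : ℝ →ₐ[ℝ] ℂ) (δ : ℕ) (χ : Weight (Fin k)) :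
    ∃ X : UniversalEnvelopingAlgebra ℂ ((ℝ →ₐ[ℝ] ℂ) → Matrix (Fin k) (Fin k) ℂ),
      X ∈ fil (HCCore.stdB (ℝ →ₐ[ℝ] ℂ) k) ((k + 1) * (δ * d + 1) ^ k) ∧
        ∀ Δ : MvPolynomial (DegIdx (Fin k) d) ℂ, Δ.IsHomogeneous δ →
          envActGL k d τ₀ X Δ ∈ highestWeightSpace (coordRep (Fin k) ℂ d) χ ∧
            Δ - envActGL k d τ₀ X Δ ∈
              (⨆ χ' ∈ {χ' : Weight (Fin k) | χ' ≠ χ}, hwSubrep (coordRep (Fin k) ℂ d) χ') ⊔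
                (⨆ χ' ∈ {χ' : Weight (Fin k) | χ' ≠ χ}, weightSpace (coordRep (Fin k) ℂ d) χ') := by
  obtain ⟨Z, hZfil, hZ⟩ := cor_5_6_length (d := d) τ₀ δ χ
  obtain ⟨H, hHfil, hH⟩ := cor_5_5_length τ₀ k d δ χ
  refine ⟨H * Z, ?_, fun Δ hΔ => ?_⟩
  · have h := mul_mem_fil (HCCore.stdB (ℝ →ₐ[ℝ] ℂ) k) hHfil hZfil
    refine fil_mono (HCCore.stdB (ℝ →ₐ[ℝ] ℂ) k) (le_of_eq ?_) h
    ring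
  · obtain ⟨hy, hΔy⟩ := hZ Δ hΔ
    -- `Z Δ` lies in the orbit span of `Δ`, hence is homogeneous of degree `δ`
    have hyspan := apply_self_mem_span_orbit_of_mem_adjoin_lieOp Δ (envActGL_mem_adjoin_lieOp τ₀ Z)
    have hyhom : (envActGL k d τ₀ Z Δ).IsHomogeneous δ := isHomogeneous_of_mem_span_orbit hΔ hyspan
    rw [map_mul, Module.End.mul_apply, hH _ hyhom]
    constructor
    · exact weightedHomogeneousComponent_mem_highestWeightSpace_of_mem_span _
        (fun p hp => isHomogeneous_of_mem_span_orbit hΔ hp) χ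
        (mem_span_translates_of_isotypicComponent hΔ hy hΔy)
    · have heq : Δ - weightedHomogeneousComponent
          (fun μ : DegIdx (Fin k) d => (fun i : Fin k => -((μ.1 i : ℕ) : ℤ))) χ (envActGL k d τ₀ Z Δ) =
          (Δ - envActGL k d τ₀ Z Δ) + (envActGL k d τ₀ Z Δ - weightedHomogeneousComponent
            (fun μ : DegIdx (Fin k) d => (fun i : Fin k => -((μ.1 i : ℕ) : ℤ))) χ (envActGL k d τ₀ Z Δ)) := by
        abel
      rw [heq]
      exact Submodule.add_mem_sup hΔy (sub_weightedHomogeneousComponent_mem χ _)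

end Cor57Length

end BergEtAl2024

end Literature.Barriers.ValiantsHypothesis
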